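import Mathlib
import HarnessLib
import Summits.HubbardSuperconductivity.HubbardSuperconductivity.Theorems.KLProgrammeKLRegimeSplitEdgeFactsRegimeJets
import Summits.HubbardSuperconductivity.HubbardSuperconductivity.Theorems.KLProgrammeKLRegimeSplitOnWindow

/-!
# Route `KLProgramme` — edge facts for the pair masses ACROSS TRANSFERS, XXII: the (D3′) PER-STEP PINNED FLOOR ON THE COVARIANCE WINDOW `klWindowC` —
# the μ-window numbers of `klrg_pinned_mass_floor_of_windows` made EXPLICIT (`u = 0`, `w = π/2`, `A′ = −(79/100)Λ_n`, `B′ = −(17/24)Λ_n`, `W = Λ_n/3`)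

Cell gate-hubbard-kl, seat hubbard-kl-k3c1-p1 (g22; child-1 lineage).  E1 docket (3)/(5′)(s2), (D3′) half: rows 27–33 reduced the per-step pinned floor of the complementary
members to «μ-window numbers» `(k, W, A′, B′, u, w)`; `…RegimeJets` keyed the one-call to the regime (`v = 4 + 2A`, `A = 2Gfr₀|U| + 2Gfr₁U² + Gfr₂·c/log 4 ≤ 2`).
THIS FILE supplies the numbers on the registered window `μ ∈ klWindowC = [−1.05, −0.15]` for a frame with small plain coefficient weight `coeffNorm 0 K ≤ 1/20`
(every flow frame: `coeffNorm 0 K_n ≤ 1370·cr·|U|·e₀`, `…VolumeLimitFlowFramesCoeffNorm`) at scales `1 ≤ n`: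
* §1 the windows: `A′ = −(79/100)Λ_n ≤ B′ = −(17/24)Λ_n ≤ 0`, `Λ_n²/2 ≤ B′²`, `A′² ≤ 5Λ_n²/8`, `B′ − A′ = (49/600)Λ_n`; `W = Λ_n/3`, `W² ≤ Λ_n²/8`; the angular
  window `u = 0`, `w = π/2`: `(−2 − μ + κ₀ − A′)/2 ≤ 0 = cos(π/2)` (`μ ≥ −1.05`, `κ₀ ≤ 1/20`, `Λ_n ≤ 1/128`) and `1 = cos 0 ≤ (2cos(π/L) − μ − κ₀ − B′)/2`
  (`μ ≤ −0.15`, `2 − 2cos(π/L) ≤ (π/L)² ≤ 1/10` for `L ≥ 10`);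
* §2 **`klwn_pinned_mass_floor`**: for `μ ∈ klWindowC`, `coeffNorm 0 K ≤ 1/20`, `1 ≤ n`, `n + 1 ≤ m`, `10 ≤ L`, the column threshold
  `0 ≤ (49/600)Λ_n·L/(2π(4 + 2A)) − 1` and ANY Matsubara index `k ≤ M` with `(2k − 1)π/β ≤ Λ_n/3`:
  `(64/243)·2k·(L/4 − 1)·((49/600)Λ_n L/(2π(4 + 2A)) − 1)/(βL²Λ_n²) ≤ −Σ_p t_n[s_{n,m}](0,p)`;
* §3 **`klwn_pinned_mass_floor_flat`** — the n-FLAT floor: if moreover `2 ≤ (49/600)Λ_n·L/(2π(4 + 2A))` and `βΛ_n/(6π) ≤ 2k` (the caller's `k`, available while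
  `βΛ_n ≥ 6π`, i.e. at every scale but the last `O(1)` above the thermal one), then **`3136/(27993600·π²·(4 + 2A)) ≤ −Σ_p t_n[s_{n,m}](0,p)`** — a per-step floor
  `b_lo ≥ 1.4·10⁻⁶` (`A ≤ 2`), uniform in `n, m, β, L, M`; the exceptional last scales go into `s₀` of `klcf_cumulative_floor_all` (row 33).
Pure composition + arithmetic; no definitions; nothing asserts any slot, stub, K3 or SC.  What stays E1's: the NAMING (N) of the masses and the choice of `k` per scale.
References: the (D3′) mechanism is the Cooper logarithm's per-scale constant [folklore]; frame sizes along the flow [cite: BenfattoGiulianiMastropietro2006, §2.4 (2.36)].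
-/

noncomputable section

namespace Summit.HubbardSuperconductivity.HubbardSuperconductivity.Theorems.KLRegimeSplit

set_option linter.dupNamespace false -- summit = problem name (single-conjunct summit), D-0017

open Real Finset Literature.MathematicalPhysics.QuantumLattice Literature.Probability.LatticeModels
open Summit.HubbardSuperconductivity.HubbardSuperconductivity.Theorems.KLProgrammeLegKernels
open Summit.HubbardSuperconductivity.HubbardSuperconductivity.Theorems.DispersionFlow
open Summit.HubbardSuperconductivity.HubbardSuperconductivity.Theorems.PerturbedFermiCurve

/-! ## §1 The windows on `klWindowC` -/

section Windows

/-- `Λ_n ≤ 1/128` for `1 ≤ n` (`Λ_n = 4^{−n}/32`). [folklore] -/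
theorem klwn_klScale_le (n : ℕ) (hn : 1 ≤ n) : klScale klE0 n ≤ 1 / 128 := by
  have h4 : (4 : ℝ) ≤ (4 : ℝ) ^ n := by
    calc (4 : ℝ) = 4 ^ 1 := by norm_num
      _ ≤ 4 ^ n := pow_le_pow_right₀ (by norm_num) hn
  have hΛ : klScale klE0 n = 1 / 32 * ((4 : ℝ) ^ n)⁻¹ := by simp [klScale, klE0]
  rw [hΛ]
  have h4pos : (0 : ℝ) < (4 : ℝ) ^ n := by positivity
  have hinv : ((4 : ℝ) ^ n)⁻¹ ≤ 1 / 4 := by rw [inv_eq_one_div, div_le_div_iff₀ h4pos (by norm_num)]; linarith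
  linarith

/-- The level window `A′ = −(79/100)Λ`, `B′ = −(17/24)Λ` is admissible: `A′ ≤ B′ ≤ 0`, `Λ²/2 ≤ B′²`, `A′² ≤ 5Λ²/8`, and `B′ − A′ = (49/600)Λ`. [folklore] -/
theorem klwn_level_window {Λ : ℝ} (hΛ : 0 ≤ Λ) :
    -(79 / 100 * Λ) ≤ -(17 / 24 * Λ) ∧ -(17 / 24 * Λ) ≤ 0 ∧ Λ ^ 2 / 2 ≤ (-(17 / 24 * Λ)) ^ 2 ∧ (-(79 / 100 * Λ)) ^ 2 ≤ 5 * Λ ^ 2 / 8 ∧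
      -(17 / 24 * Λ) - -(79 / 100 * Λ) = 49 / 600 * Λ := by
  refine ⟨by linarith, by linarith, ?_, ?_, by ring⟩
  · nlinarith [sq_nonneg Λ]
  · nlinarith [sq_nonneg Λ]

/-- The Matsubara window `W = Λ/3`: `W² ≤ Λ²/8`. [folklore] -/
theorem klwn_freq_window (Λ : ℝ) : (Λ / 3) ^ 2 ≤ Λ ^ 2 / 8 := by nlinarith [sq_nonneg Λ]

/-- The LOWER angular criterion at `w = π/2` on `klWindowC`: `μ ≥ −1.05`, `κ₀ ≤ 1/20`, `Λ ≤ 1/128` ⟹ `(−2 − μ + κ₀ − A′)/2 ≤ cos(π/2)` (`A′ = −(79/100)Λ`). [folklore] -/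
theorem klwn_win_lo {μ κ₀ Λ : ℝ} (hμ : μ ∈ klWindowC) (hκ₀ : κ₀ ≤ 1 / 20) (hΛ : Λ ≤ 1 / 128) :
    (-2 - μ + κ₀ - -(79 / 100 * Λ)) / 2 ≤ Real.cos (π / 2) := by
  rw [Real.cos_pi_div_two]
  have h1 : -1.05 ≤ μ := hμ.1
  linarith

/-- The UPPER angular criterion at `u = 0` on `klWindowC`: `μ ≤ −0.15`, `κ₀ ≤ 1/20`, `0 ≤ Λ`, `10 ≤ L` ⟹ `cos 0 ≤ (2cos(π/L) − μ − κ₀ − B′)/2` (`B′ = −(17/24)Λ`;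
`2 − 2cos(π/L) ≤ (π/L)² ≤ π²/100 < 1/10`). [folklore] -/
theorem klwn_win_hi {μ κ₀ Λ : ℝ} (hμ : μ ∈ klWindowC) (hκ₀ : κ₀ ≤ 1 / 20) (hΛ0 : 0 ≤ Λ) {L : ℕ} (hL : 10 ≤ L) :
    Real.cos 0 ≤ (2 * Real.cos (π / L) - μ - κ₀ - -(17 / 24 * Λ)) / 2 := by
  rw [Real.cos_zero]
  have h2 : μ ≤ -0.15 := hμ.2
  have hL' : (10 : ℝ) ≤ L := by exact_mod_cast hL
  have hLpos : (0 : ℝ) < L := by linarith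
  have hcos : 1 - (π / L) ^ 2 / 2 ≤ Real.cos (π / L) := Real.one_sub_sq_div_two_le_cos
  have hx : (π / L) ^ 2 ≤ 1 / 10 := by
    have hπ : π < 3.15 := Real.pi_lt_d2
    have hπ0 : 0 < π := Real.pi_pos
    have hq : π / L ≤ 3.15 / 10 := by
      rw [div_le_div_iff₀ hLpos (by norm_num)]; nlinarith
    have hq0 : 0 ≤ π / L := by positivity
    nlinarith
  linarith

end Windows

/-! ## §2 The per-step pinned floor on `klWindowC`, keyed to the regime -/

section Floor

variable {L M : ℕ} [NeZero L] (β μ : ℝ) {K : TrigPolyC4v}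
variable {R : RenConsts} (hR : ∀ j, 0 ≤ R.Gfr j) {U c βf : ℝ} (hc : 0 ≤ c) (hβmin : klBetaMin ≤ βf) (hβc : βf ≤ Real.exp (c / U ^ 2))
  (hK : FrameOK R U (nScales βf) μ K)
include hR hc hβmin hβc hK

/-- **THE (D3′) PER-STEP PINNED FLOOR ON `klWindowC`** (module docstring, §2): explicit windows, any admissible Matsubara index `k`. [folklore] -/
theorem klwn_pinned_mass_floor [NeZero M] (hβ : 0 < β) (hμ : μ ∈ klWindowC) (hκ₀ : K.coeffNorm 0 ≤ 1 / 20) {n m : ℕ} (hn : 1 ≤ n)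
    (hnm : n + 1 ≤ m) (hL : 10 ≤ L) {k : ℕ} (hk : k ≤ M) (hkW : (2 * (k : ℝ) - 1) * π / β ≤ klScale klE0 n / 3)
    (hX : 0 ≤ 49 / 600 * klScale klE0 n * L / (2 * π * (4 + 2 * (2 * R.Gfr 0 * |U| + 2 * R.Gfr 1 * U ^ 2 + R.Gfr 2 * (c / Real.log 4)))) - 1) :
    64 / 243 * (2 * (k : ℝ) * ((((π / 2 - 0) * L / (2 * π) - 1)) *
        (49 / 600 * klScale klE0 n * L / (2 * π * (4 + 2 * (2 * R.Gfr 0 * |U| + 2 * R.Gfr 1 * U ^ 2 + R.Gfr 2 * (c / Real.log 4)))) - 1)) /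
        (β * (L : ℝ) ^ 2 * klScale klE0 n ^ 2)) ≤
      -∑ p, klTransferWeight L M β μ K n (softSymbolCompl L M β μ K n m) 0 p := by
  have hΛ0 : 0 ≤ klScale klE0 n := (klth_klScale_pos n).le
  have hΛ := klwn_klScale_le n hn
  obtain ⟨hAB, hB, hB2, hA2', hBA⟩ := klwn_level_window hΛ0
  have hW2 := klwn_freq_window (klScale klE0 n)
  have hlo := klwn_win_lo (Λ := klScale klE0 n) hμ hκ₀ hΛ
  have hhi := klwn_win_hi (Λ := klScale klE0 n) hμ hκ₀ hΛ0 hL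
  have hX' : 0 ≤ (-(17 / 24 * klScale klE0 n) - -(79 / 100 * klScale klE0 n)) * L /
      (2 * π * (4 + 2 * (2 * R.Gfr 0 * |U| + 2 * R.Gfr 1 * U ^ 2 + R.Gfr 2 * (c / Real.log 4)))) - 1 := by
    rw [hBA]; exact hX
  have h := klrg_pinned_mass_floor_of_windows β μ hR hc hβmin hβc hK hβ hnm hk hkW hW2 hAB hB hB2 hA2' hX'
    (u := 0) (w := π / 2) le_rfl (by positivity) (by linarith [Real.pi_pos]) hlo hhi
  rw [hBA] at h
  exact h

/-! ## §3 The n-flat floor -/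

/-- **THE n-FLAT PER-STEP FLOOR ON `klWindowC`**: with the column threshold strengthened to `2 ≤ (49/600)Λ_n L/(2π(4 + 2A))` and a Matsubara index with
`βΛ_n/(6π) ≤ 2k` (as well as `(2k − 1)π/β ≤ Λ_n/3`, `k ≤ M`), the floor is the CONSTANT `3136/(27993600·π²·(4 + 2A))` — uniform in `n, m, β, L, M`
(`2k ≥ βΛ_n/(6π)`, `L/4 − 1 ≥ L/8`, `X ≥ (49/1200)Λ_n L/(2π(4+2A))`, and `βL²Λ_n²` cancels). [folklore] -/
theorem klwn_pinned_mass_floor_flat [NeZero M] (hβ : 0 < β) (hμ : μ ∈ klWindowC) (hκ₀ : K.coeffNorm 0 ≤ 1 / 20) {n m : ℕ} (hn : 1 ≤ n)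
    (hnm : n + 1 ≤ m) (hL : 10 ≤ L) {k : ℕ} (hk : k ≤ M) (hkW : (2 * (k : ℝ) - 1) * π / β ≤ klScale klE0 n / 3)
    (hklo : β * klScale klE0 n / (6 * π) ≤ 2 * (k : ℝ))
    (hX2 : 2 ≤ 49 / 600 * klScale klE0 n * L / (2 * π * (4 + 2 * (2 * R.Gfr 0 * |U| + 2 * R.Gfr 1 * U ^ 2 + R.Gfr 2 * (c / Real.log 4))))) :
    3136 / (27993600 * π ^ 2 * (4 + 2 * (2 * R.Gfr 0 * |U| + 2 * R.Gfr 1 * U ^ 2 + R.Gfr 2 * (c / Real.log 4)))) ≤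
      -∑ p, klTransferWeight L M β μ K n (softSymbolCompl L M β μ K n m) 0 p := by
  set v : ℝ := 4 + 2 * (2 * R.Gfr 0 * |U| + 2 * R.Gfr 1 * U ^ 2 + R.Gfr 2 * (c / Real.log 4)) with hv
  have hv4 : 4 ≤ v := by have := klrg_size_nonneg hR hc (U := U); rw [hv]; linarith
  have hv0 : 0 < v := by linarith
  have hπ := Real.pi_pos
  have hΛpos : 0 < klScale klE0 n := klth_klScale_pos n
  have hL' : (10 : ℝ) ≤ L := by exact_mod_cast hL
  have hLpos : (0 : ℝ) < L := by linarith
  have hX : 0 ≤ 49 / 600 * klScale klE0 n * L / (2 * π * v) - 1 := by linarith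
  have h := klwn_pinned_mass_floor β μ hR hc hβmin hβc hK hβ hμ hκ₀ hn hnm hL hk hkW hX
  refine le_trans ?_ h
  -- the three factors from below
  set X : ℝ := 49 / 600 * klScale klE0 n * L / (2 * π * v) - 1 with hXdef
  set Y : ℝ := (π / 2 - 0) * L / (2 * π) - 1 with hYdef
  have hY : (L : ℝ) / 8 ≤ Y := by
    have e : Y = (L : ℝ) / 4 - 1 := by rw [hYdef]; field_simp; ring
    rw [e]; linarith
  have hXlo : 49 / 1200 * klScale klE0 n * L / (2 * π * v) ≤ X := by
    have e : 49 / 1200 * klScale klE0 n * L / (2 * π * v) = (49 / 600 * klScale klE0 n * L / (2 * π * v)) / 2 := by ring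
    rw [e, hXdef]; linarith
  have hY0 : 0 ≤ (L : ℝ) / 8 := by positivity
  have hXlo0 : 0 ≤ 49 / 1200 * klScale klE0 n * L / (2 * π * v) := by positivity
  have hk0 : 0 ≤ β * klScale klE0 n / (6 * π) := by positivity
  -- product of the lower bounds
  have hprod : β * klScale klE0 n / (6 * π) * ((L : ℝ) / 8 * (49 / 1200 * klScale klE0 n * L / (2 * π * v))) ≤ 2 * (k : ℝ) * (Y * X) :=
    mul_le_mul hklo (mul_le_mul hY hXlo hXlo0 ((hY0).trans hY)) (mul_nonneg hY0 hXlo0) (hk0.trans hklo)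
  have hden : 0 < β * (L : ℝ) ^ 2 * klScale klE0 n ^ 2 := by positivity
  have hid : 3136 / (27993600 * π ^ 2 * v) =
      64 / 243 * (β * klScale klE0 n / (6 * π) * ((L : ℝ) / 8 * (49 / 1200 * klScale klE0 n * L / (2 * π * v))) /
        (β * (L : ℝ) ^ 2 * klScale klE0 n ^ 2)) := by
    field_simp
    ring
  rw [hid]
  exact mul_le_mul_of_nonneg_left (div_le_div_of_nonneg_right hprod hden.le) (by norm_num)

end Floor

end Summit.HubbardSuperconductivity.HubbardSuperconductivity.Theorems.KLRegimeSplit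

end
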